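import Summits.Ventures.Crystal3D.Theorems.StickyWulffConstantNoReconstructionGainConfinedCertificateThin
import Summits.Ventures.Crystal3D.Theorems.StickyWulffConstantNoReconstructionGainHollowPair
import Literature.Geometry.DiscreteGeometry.KerteszAzimuthArcs
import Mathlib.Analysis.SpecialFunctions.Complex.Arg
import HarnessLib

/-!
# The hollow-ball row of the `W = √(2/3)` certificate: a linearly weighted one-sided kissing bound
# (crux `NoReconstructionGain`, stmt-Ventures-19144, line `replication-exactness`, inside `stub_noCriminal`)

HONEST FRAMING. Part of the venture `Summits/Ventures/Crystal3D` (cell `crystal3d-full`), helper `--supports` the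
crux `NoReconstructionGain` (stmt-Ventures-19144, route `route-Ventures-StickyWulffConstant`), lead wulff-p1 g24.
A RUNG of the pointwise ("weighted kissing") method for height-confined `(111)` films, not a resolution of the crux.

THE INEQUALITY.  Write `c = √(2/3)` (the layer spacing of the close packing of unit balls).  For every finite
`60°`-code `F ⊂ S²` (unit vectors of `ℝ³`, pairwise inner products `≤ 1/2`):

  `Σ_{u ∈ F, 0 ≤ u₂ ≤ c} (1 − u₂ / c) ≤ 6`                                   (`weightedCapKissing_le_six`)

— every code vector in the "cap zone" `0 ≤ u₂ ≤ c` above the equator weighs `1` on the equator, linearly less above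
it, `0` at height `c`, and the total weight is at most six.  TIGHT exactly at the close-packed codes: a regular
hexagon on the equator plus `k ≤ 3` vectors at height `c` over alternate gaps (weight `6·1 + k·0`).  Corollaries:
`m` code vectors in the cap zone have `Σ u₂ ≥ (m − 6)·c` (`sum_height_ge_of_capZone`: the lemmas (K7), (K8), (K9)
of the cell record CONFINED-CERT-g20 §5a in one stroke), and — the reason for the name — the OFFSET-ZERO ROW of the
windowed weighted-kissing bound `ConfinedCodeBoundPhys √(2/3) g` for the clipped linear ramp
`g z = min 2 (max 0 (1 − z/c))` (`hollowRow_ramp`): the full neighbour code of a HOLLOW ball of a `(111)` film whose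
partners lie at most `c` above it (plug directions at `u₂ = −c`, at most three of them by
`card_mul_sq_le_of_sameHeight`; partner directions in `[0, c]`) has `g`-weight `≤ 12`, i.e. `plug + Σ y ≤ 6` for the
fractional orientation `y = g/2` of `not_isCriminal_basal_of_confinedCodeBoundPhys`.  The other rows of the
`W = √(2/3)` window (offsets `a ∈ [−c, 0)`, in particular the top-ball row `a = −c`, tight at Kertész's nine-point
code) are NOT proved here; with them, p718884's reduction would give «no `(111)` criminal below height `(k+2)√(2/3)`»
(the bilayer-hollow class).  Today the kernel has the rows for `W ≤ 1/2` only (`confinedCodeBoundPhys_of_half`).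

THE PROOF — a WEIGHTED AZIMUTH BUDGET about the pole (Kertész's/Musin's projection, with weights; the
real-variable tools are in `…NoReconstructionGainHollowPair`):
* PAIR LEMMA (`hollow_azimuthGap_ge`): two code vectors `u, v` in the cap zone differ in azimuth (either way
  round) by `≥ ω(u) + ω(v)`, `ω(u) := (π/6)(1 − u₂/c)`.  By the spherical law of cosines
  `cos Δθ ≤ (1/2 − u₂v₂)/(ρ_u ρ_v)`, `ρ = √(1 − u₂²)`, and `1/2 − u₂v₂ ≤ ρ_u ρ_v cos(ω(u)+ω(v))` is
  `hollowPair_cos_bound` (chords of `cos` + two polynomial inequalities; tight at the Barlow pairs: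
  equator–equator gap `60°`, equator–top gap `30°`).
* WALK (`azimuth_weighted_budget`): sorting by azimuth, consecutive gaps sum to `2π`, so `2 Σ ω ≤ 2π`, i.e.
  `Σ (1 − u₂/c) ≤ 6`.

WHAT THIS IS NOT: not a proof of `ConfinedCodeBoundPhys √(2/3) g` (one offset of a continuum), not a film theorem, not
Kertész's theorem (which is the rigidity statement behind the tight case and is in the tree separately,
`kertesz1994_ninePointsHemisphere_holds`); the crux proper (unconfined films) and rung F-C1 are not moved.
-/

noncomputable section

namespace Summit.Ventures.Crystal3D.Theorems

open Finset Real
open scoped InnerProductSpace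

/-! ## 3. Geometry: azimuths about the pole `e₃` -/

/-- `⟪x, y⟫ = x₀y₀ + x₁y₁ + x₂y₂` in `ℝ³`. -/
private theorem inner_three (x y : EuclideanSpace ℝ (Fin 3)) :
    ⟪x, y⟫_ℝ = x 0 * y 0 + x 1 * y 1 + x 2 * y 2 := by
  simp [PiLp.inner_apply, Fin.sum_univ_three, mul_comm]

/-- `‖x‖² = x₀² + x₁² + x₂²` in `ℝ³`. -/
private theorem norm_sq_three (x : EuclideanSpace ℝ (Fin 3)) :
    ‖x‖ ^ 2 = x 0 ^ 2 + x 1 ^ 2 + x 2 ^ 2 := by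
  rw [← real_inner_self_eq_norm_sq, inner_three]; ring

/-- The horizontal part of a unit vector of height `z` (as a complex number) has norm `√(1 − z²)`. -/
private theorem norm_horiz {u : EuclideanSpace ℝ (Fin 3)} (hu : ‖u‖ = 1) :
    ‖(⟨u 0, u 1⟩ : ℂ)‖ = Real.sqrt (1 - u 2 ^ 2) := by
  have h2 : ‖(⟨u 0, u 1⟩ : ℂ)‖ ^ 2 = 1 - u 2 ^ 2 := by
    rw [Complex.sq_norm, Complex.normSq_mk]
    have := norm_sq_three u
    rw [hu, one_pow] at this
    nlinarith [this]
  rw [← h2, Real.sqrt_sq (norm_nonneg _)]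

/-- **The pair lemma (azimuth form).**  Two unit vectors `u ≠ v` of `ℝ³` with `⟪u, v⟫ ≤ 1/2`, both in the
cap zone `0 ≤ ·₂ ≤ √(2/3)`, whose azimuths about `e₃` (arguments of the horizontal parts, in `(−π, π]`)
satisfy `θ_u ≤ θ_v`, have `θ_v − θ_u ≥ ω(u) + ω(v)` AND `2π − (θ_v − θ_u) ≥ ω(u) + ω(v)`, where
`ω(w) = (π/6)(1 − w₂/√(2/3))`. -/
theorem hollow_azimuthGap_ge {u v : EuclideanSpace ℝ (Fin 3)} (hu : ‖u‖ = 1) (hv : ‖v‖ = 1)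
    (huv : ⟪u, v⟫_ℝ ≤ 1 / 2)
    (hu0 : 0 ≤ u 2) (hu1 : u 2 ≤ Real.sqrt (2 / 3)) (hv0 : 0 ≤ v 2) (hv1 : v 2 ≤ Real.sqrt (2 / 3))
    (hθ : Complex.arg ⟨u 0, u 1⟩ ≤ Complex.arg ⟨v 0, v 1⟩) :
    π / 6 * (1 - u 2 / Real.sqrt (2 / 3)) + π / 6 * (1 - v 2 / Real.sqrt (2 / 3)) ≤
        Complex.arg ⟨v 0, v 1⟩ - Complex.arg ⟨u 0, u 1⟩ ∧
      π / 6 * (1 - u 2 / Real.sqrt (2 / 3)) + π / 6 * (1 - v 2 / Real.sqrt (2 / 3)) ≤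
        2 * π - (Complex.arg ⟨v 0, v 1⟩ - Complex.arg ⟨u 0, u 1⟩) := by
  set c : ℝ := Real.sqrt (2 / 3) with hc
  have hc2 : c ^ 2 = 2 / 3 := Real.sq_sqrt (by norm_num)
  have hcpos : 0 < c := Real.sqrt_pos.2 (by norm_num)
  -- heights as fractions of `c`
  set a : ℝ := u 2 / c with ha_def
  set b : ℝ := v 2 / c with hb_def
  have hua : u 2 = c * a := by rw [ha_def]; field_simp
  have hvb : v 2 = c * b := by rw [hb_def]; field_simp
  have ha0 : 0 ≤ a := div_nonneg hu0 hcpos.le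
  have hb0 : 0 ≤ b := div_nonneg hv0 hcpos.le
  have ha1 : a ≤ 1 := by rw [ha_def, div_le_one hcpos]; exact hu1
  have hb1 : b ≤ 1 := by rw [hb_def, div_le_one hcpos]; exact hv1
  -- horizontal parts
  set zu : ℂ := ⟨u 0, u 1⟩ with hzu
  set zv : ℂ := ⟨v 0, v 1⟩ with hzv
  have hnu : ‖zu‖ = Real.sqrt (1 - 2 / 3 * a ^ 2) := by
    rw [hzu, norm_horiz hu, hua, mul_pow, hc2]
  have hnv : ‖zv‖ = Real.sqrt (1 - 2 / 3 * b ^ 2) := by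
    rw [hzv, norm_horiz hv, hvb, mul_pow, hc2]
  have hXpos : 0 < 1 - 2 / 3 * a ^ 2 := by nlinarith
  have hYpos : 0 < 1 - 2 / 3 * b ^ 2 := by nlinarith
  have hnu0 : 0 < ‖zu‖ := by rw [hnu]; exact Real.sqrt_pos.2 hXpos
  have hnv0 : 0 < ‖zv‖ := by rw [hnv]; exact Real.sqrt_pos.2 hYpos
  have hzu0 : zu ≠ 0 := norm_pos_iff.1 hnu0
  have hzv0 : zv ≠ 0 := norm_pos_iff.1 hnv0
  -- the inner product in polar form
  have hin : ⟪u, v⟫_ℝ = ‖zu‖ * ‖zv‖ * Real.cos (Complex.arg zu - Complex.arg zv) + u 2 * v 2 := by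
    rw [inner_three, ← re_mul_add_im_mul zu zv hzu0 hzv0]
  -- the pair bound: `‖zu‖‖zv‖ cos Δθ ≤ 1/2 − u₂ v₂ ≤ ‖zu‖‖zv‖ cos B`
  set B : ℝ := π / 3 - π / 6 * (a + b) with hB
  have hB0 : 0 ≤ B := by rw [hB]; nlinarith [pi_pos]
  have hBπ : B ≤ π := by rw [hB]; nlinarith [pi_pos]
  have hpair := hollowPair_cos_bound ha0 ha1 hb0 hb1
  rw [← hnu, ← hnv] at hpair
  have h1 : ‖zu‖ * ‖zv‖ * Real.cos (Complex.arg zu - Complex.arg zv) ≤ ‖zu‖ * ‖zv‖ * Real.cos B := by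
    have : u 2 * v 2 = 2 / 3 * a * b := by
      rw [hua, hvb]
      have e : c * a * (c * b) = c ^ 2 * (a * b) := by ring
      rw [e, hc2]; ring
    rw [hB]
    linarith [hin, huv, hpair, this]
  have hcosle : Real.cos (Complex.arg zv - Complex.arg zu) ≤ Real.cos B := by
    rw [← Real.cos_neg, neg_sub]
    exact le_of_mul_le_mul_left h1 (mul_pos hnu0 hnv0)
  -- both arcs
  have hx0 : 0 ≤ Complex.arg zv - Complex.arg zu := by linarith
  have hx1 : Complex.arg zv - Complex.arg zu ≤ 2 * π := by
    linarith [Complex.arg_le_pi zv, Complex.neg_pi_lt_arg zu]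
  have harc := Literature.Geometry.DiscreteGeometry.arccos_le_and_le_of_cos_le hx0 hx1 hcosle
  rw [Real.arccos_cos hB0 hBπ] at harc
  have hω : π / 6 * (1 - u 2 / c) + π / 6 * (1 - v 2 / c) = B := by
    rw [hB, ← ha_def, ← hb_def]; ring
  rw [hω]
  exact harc

/-! ## 4. The weighted one-sided kissing bound -/

/-- **Linearly weighted one-sided kissing bound (the hollow-ball load bound).**  For every finite `60°`-code
`F` of unit vectors of `ℝ³` (pairwise inner products `≤ 1/2`), the vectors in the cap zone
`0 ≤ u₂ ≤ √(2/3)` have total weight `Σ (1 − u₂/√(2/3)) ≤ 6`.  Tight at the close-packed codes (regular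
hexagon on the equator plus up to three vectors at height `√(2/3)`).  Proof: weighted azimuth budget with the
pair lemma `hollow_azimuthGap_ge`. -/
theorem weightedCapKissing_le_six (F : Finset (EuclideanSpace ℝ (Fin 3))) (h1 : ∀ u ∈ F, ‖u‖ = 1)
    (h2 : ∀ u ∈ F, ∀ v ∈ F, u ≠ v → ⟪u, v⟫_ℝ ≤ 1 / 2) :
    ∑ u ∈ F.filter (fun u => 0 ≤ u 2 ∧ u 2 ≤ Real.sqrt (2 / 3)), (1 - u 2 / Real.sqrt (2 / 3)) ≤ 6 := by
  classical
  set c : ℝ := Real.sqrt (2 / 3) with hc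
  have hcpos : 0 < c := Real.sqrt_pos.2 (by norm_num)
  set S := F.filter (fun u => 0 ≤ u 2 ∧ u 2 ≤ c) with hS
  have hSmem : ∀ u, u ∈ S ↔ u ∈ F ∧ 0 ≤ u 2 ∧ u 2 ≤ c := fun u => by rw [hS, mem_filter]
  set t : EuclideanSpace ℝ (Fin 3) → ℝ := fun u => Complex.arg ⟨u 0, u 1⟩ with ht
  set f : EuclideanSpace ℝ (Fin 3) → ℝ := fun u => π / 6 * (1 - u 2 / c) with hf
  have hfle : ∀ u ∈ S, f u ≤ π := by
    intro u hu
    have hu := (hSmem u).1 hu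
    have : 0 ≤ u 2 / c := div_nonneg hu.2.1 hcpos.le
    simp only [hf]
    nlinarith [pi_pos]
  have hgap : ∀ a ∈ S, ∀ b ∈ S, a ≠ b → t a ≤ t b →
      f a + f b ≤ t b - t a ∧ f a + f b ≤ 2 * π - (t b - t a) := by
    intro a ha b hb hab htab
    have ha' := (hSmem a).1 ha
    have hb' := (hSmem b).1 hb
    exact hollow_azimuthGap_ge (h1 a ha'.1) (h1 b hb'.1) (h2 a ha'.1 b hb'.1 hab) ha'.2.1 ha'.2.2 hb'.2.1
      hb'.2.2 htab
  have hsum := azimuth_weighted_budget t f S hfle hgap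
  have hrew : ∑ x ∈ S, f x = π / 6 * ∑ x ∈ S, (1 - x 2 / c) := by
    rw [hf, mul_sum]
  rw [hrew] at hsum
  have hπ := pi_pos
  by_contra hlt
  push Not at hlt
  nlinarith [hsum, hlt]

/-- **Corollary (K7)–(K9): heights in the cap zone.**  If `m` vectors of a `60°`-code lie in the cap zone
`0 ≤ u₂ ≤ √(2/3)`, their heights sum to at least `(m − 6)·√(2/3)`: seven such vectors have `Σ u₂ ≥ √(2/3)`,
eight have `Σ u₂ ≥ 2√(2/3)`, nine have `Σ u₂ ≥ 3√(2/3)` (tight at hexagon `+ 1, 2, 3`). -/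
theorem sum_height_ge_of_capZone (F : Finset (EuclideanSpace ℝ (Fin 3))) (h1 : ∀ u ∈ F, ‖u‖ = 1)
    (h2 : ∀ u ∈ F, ∀ v ∈ F, u ≠ v → ⟪u, v⟫_ℝ ≤ 1 / 2)
    (hcap : ∀ u ∈ F, 0 ≤ u 2 ∧ u 2 ≤ Real.sqrt (2 / 3)) :
    ((F.card : ℝ) - 6) * Real.sqrt (2 / 3) ≤ ∑ u ∈ F, u 2 := by
  classical
  have hcpos : 0 < Real.sqrt (2 / 3) := Real.sqrt_pos.2 (by norm_num)
  have h := weightedCapKissing_le_six F h1 h2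
  have hfilt : F.filter (fun u => 0 ≤ u 2 ∧ u 2 ≤ Real.sqrt (2 / 3)) = F :=
    filter_true_of_mem fun u hu => hcap u hu
  rw [hfilt, sum_sub_distrib, sum_const, nsmul_eq_mul, mul_one, ← sum_div] at h
  have h' : (F.card : ℝ) - 6 ≤ (∑ u ∈ F, u 2) / Real.sqrt (2 / 3) := by linarith
  rwa [le_div_iff₀ hcpos] at h'

/-! ## 5. The offset-zero (hollow-ball) row of the `W = √(2/3)` windowed bound -/

/-- **The hollow-ball row.**  The offset-`0` instance of `ConfinedCodeBoundPhys √(2/3) g` for the clipped linear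
ramp `g z = min 2 (max 0 (1 − z/√(2/3)))`: a finite `60°`-code each of whose members sits at third coordinate
exactly `−√(2/3)` (plug directions of a hollow ball: at most three of them, `card_mul_sq_le_of_sameHeight`,
weight `2` each) or in the window `[0, √(2/3)]` (partner directions, weight `1 − u₂/√(2/3)`, total `≤ 6` by
`weightedCapKissing_le_six`) has `g`-weight `≤ 12`. -/
theorem hollowRow_ramp (N : Finset (EuclideanSpace ℝ (Fin 3))) (h1 : ∀ u ∈ N, ‖u‖ = 1)
    (h2 : ∀ u ∈ N, ∀ v ∈ N, u ≠ v → ⟪u, v⟫_ℝ ≤ 1 / 2)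
    (hwin : ∀ u ∈ N, u 2 = 0 - Real.sqrt (2 / 3) ∨ (0 ≤ u 2 ∧ u 2 ≤ 0 + Real.sqrt (2 / 3))) :
    ∑ u ∈ N, min 2 (max 0 (1 - u 2 / Real.sqrt (2 / 3))) ≤ 12 := by
  classical
  set c : ℝ := Real.sqrt (2 / 3) with hc
  have hc2 : c ^ 2 = 2 / 3 := Real.sq_sqrt (by norm_num)
  have hcpos : 0 < c := Real.sqrt_pos.2 (by norm_num)
  set P := N.filter (fun u => u 2 = -c) with hP
  set S := N.filter (fun u => 0 ≤ u 2 ∧ u 2 ≤ c) with hS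
  have hPmem : ∀ u, u ∈ P ↔ u ∈ N ∧ u 2 = -c := fun u => by rw [hP, mem_filter]
  have hSmem : ∀ u, u ∈ S ↔ u ∈ N ∧ 0 ≤ u 2 ∧ u 2 ≤ c := fun u => by rw [hS, mem_filter]
  -- `N = P ∪ S`, disjointly
  have hdisj : Disjoint P S := by
    rw [Finset.disjoint_left]
    intro u huP huS
    have h1' := ((hPmem u).1 huP).2
    have h2' := ((hSmem u).1 huS).2.1
    linarith
  have hunion : N = P ∪ S := by
    ext u
    rw [mem_union, hPmem, hSmem]
    constructor
    · intro hu
      rcases hwin u hu with h | h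
      · exact Or.inl ⟨hu, by linarith⟩
      · exact Or.inr ⟨hu, h.1, by linarith [h.2]⟩
    · rintro (h | h)
      · exact h.1
      · exact h.1
  -- plugs: at most three, weight `2` each
  have hPcard : (P.card : ℝ) ≤ 3 := by
    have h := card_mul_sq_le_of_sameHeight P (-c) (fun u hu => h1 u ((hPmem u).1 hu).1)
      (fun u hu v hv huv => h2 u ((hPmem u).1 hu).1 v ((hPmem v).1 hv).1 huv)
      (fun u hu => ((hPmem u).1 hu).2)
    rw [neg_sq, hc2] at h
    linarith
  have hPsum : ∑ u ∈ P, min 2 (max 0 (1 - u 2 / c)) = 2 * P.card := by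
    rw [Finset.sum_congr rfl fun u hu => ?_, sum_const, nsmul_eq_mul, mul_comm]
    rw [((hPmem u).1 hu).2, neg_div, div_self hcpos.ne']
    norm_num
  -- partners: the weighted kissing bound
  have hSsum : ∑ u ∈ S, min 2 (max 0 (1 - u 2 / c)) = ∑ u ∈ S, (1 - u 2 / c) := by
    refine Finset.sum_congr rfl fun u hu => ?_
    have h := (hSmem u).1 hu
    have h0 : 0 ≤ 1 - u 2 / c := by
      rw [sub_nonneg, div_le_one hcpos]; exact h.2.2
    have h1' : 1 - u 2 / c ≤ 2 := by
      have : 0 ≤ u 2 / c := div_nonneg h.2.1 hcpos.le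
      linarith
    rw [max_eq_right h0, min_eq_right h1']
  have hS6 := weightedCapKissing_le_six N h1 h2
  rw [← hS] at hS6
  rw [hunion, sum_union hdisj, hPsum, hSsum]
  linarith

end Summit.Ventures.Crystal3D.Theorems

end
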